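import Summits.BirchSwinnertonDyer.Rank1Residual.Partition.Corners
import Literature.NumberTheory.EllipticCurves.Greenberg1999.IsogenyPrimesOrdinaryMultiplicative
import HarnessLib

/-!
# The strong partial theorem at LARGE primes: no corner at all at a good ordinary `p ≥ 11`,
# `p ∉ {13, 37}`; only '(ram) fails' at a multiplicative `p ≥ 11`, `p ∉ {13, 37}`, rank `0`
# (cell `b2b-bsdres`, RESIDUAL-MAP.md §A 'SPECIALISATION p ≥ 11' / §C; rmap-1 gen 4)

HONEST FRAMING (run/shared/lean/b2b/bsd-rank1-residual/, verbatim in every file): the goal of the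
cell is to DELETE the COMBINATION-SHAPED residual classes of the Birch–Swinnerton-Dyer formula for
ALL analytic-rank `≤ 1` elliptic curves over `ℚ` — "full BSD formula for every rank `≤ 1` curve in
class `C`" assembled STRICTLY from published theorems — so that the rank-`≤ 1` remainder becomes
exactly the CONSTRUCTION-SHAPED classes, which are TYPED (missing-input `Prop`s), NOT attempted.
This is not "finishing BSD". Theorems only; NO definition, NO named fact introduced here; every
published theorem enters as one of the tree's existing named Literature facts BY NAME (the fourteen
facts of `Partition/Bsdp.lean`, Balakrishnan–Dogra–Müller–Tuitman–Vonk 2019 Thm 1.2 `hBDMTV`, and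
Greenberg LNM 1716 §5 p. 136 `hGr136` = `Greenberg1999.p136_mem_isogenyPrimes_of_reducible`:
"good, ordinary or multiplicative reduction at `p` … `E[p]` reducible … then `p` is limited to the
set `{2, 3, 5, 7, 13, 37}`", after Mazur 1978); nothing about any particular curve is asserted; no
label changes; the PUB\* flags of rows C2 / C3-ss / C16 travel with `hBCS` / `hJSW` / `hYZ` as in
`Partition/Bsdp.lean`.

What `Corners.lean` (rmap-1 gen 2) left at `p ≥ 11` on the good ORDINARY axis was the single corner
X1 (a rational `p`-isogeny with anomalous kernel character outside the `r = 0 ∧ GV-parity`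
quadrant), "possible only at `p ∈ {13, 37}`" — said in the docstring, with `ClassX1` kept as the
hypothesis. With the page now vendored as a named fact, the two quotable LARGE-PRIME forms are:

* `bsdp_goodOrd_of_eleven_le_of_ne` — **every `E/ℚ` of analytic rank `≤ 1`, every good ORDINARY
  prime `p ≥ 11` with `p ≠ 13` and `p ≠ 37`: `BSD(E,p)`, NO corner** (X1 needs `E[p]` reducible,
  impossible here by `hGr136`; X9 needs `p ∈ {5, 7}` by `hBDMTV`; X10b needs `p = 3`; CM curves are
  covered outright at a good odd prime, `Corners.bsdp_goodOrd_of_irr_of_eleven_le` is already the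
  all-curves form);
* `bsdp_mult_rankZero_of_eleven_le_of_ne` — **every `E/ℚ` of analytic rank `0`, every
  MULTIPLICATIVE prime `p ≥ 11` with `p ≠ 13`, `p ≠ 37`: `BSD(E,p)` unless '(ram) fails'**
  (`ClassX11a`: no second multiplicative prime `q` with `p ∤ v_q(Δ_min)` — e.g. prime conductor
  `N = p`; NOT an image condition); the other multiplicative rank-`0` corner X2 needs `E[p]`
  reducible, impossible here by `hGr136`. Equivalently (`bsdp_mult_rankZero_of_eleven_le_of_ram`):
  with a (ram) witness, `BSD(E,p)` from three facts (Skinner 2016 Thm C, modularity, GZK).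

At `p ∈ {13, 37}` the statements of `Corners.lean` stand unchanged (corner X1 / X2 explicit).
References: RESIDUAL-MAP.md §A (SPECIALISATION `p ≥ 11`, CORNER PREDICATE), §C; HOME/PARTITION.md
§3; `Partition/Corners.lean`; Greenberg LNM 1716 §5 p. 136 [GreenbergLNM1716]; Mazur, Invent. Math.
44 (1978) Thm. 1 [Mazur1978]; Greenberg–Vatsal, Invent. Math. 142 (2000) p. 28.
-/

namespace Summit.BirchSwinnertonDyer.Rank1Residual

open WeierstrassCurve Literature.NumberTheory.EllipticCurves
  Literature.NumberTheory.EllipticCurves.Rank1Residual Literature.NumberTheory.EllipticCurves.ModularForms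
  Literature.NumberTheory.EllipticCurves.Greenberg1999
open scoped NumberField

section Curve

variable {W : WeierstrassCurve ℚ} [W.IsElliptic] [W.IsGloballyMinimal] {p : ℕ} [Fact p.Prime]

/-- **No Eisenstein corner at a large good ordinary prime**: at a good ordinary `p ≥ 11` with
`p ∉ {13, 37}`, `E[p]` is irreducible (Greenberg LNM 1716 p. 136 / Mazur 1978), so `(E, p)` is not in
X1. [folklore] -/
theorem not_classX1_of_goodOrd_of_eleven_le_of_ne (hGr136 : p136_mem_isogenyPrimes_of_reducible)
    (hgo : GoodOrd W p) (h11 : 11 ≤ p) (h13 : p ≠ 13) (h37 : p ≠ 37) : ¬ ClassX1 W p :=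
  fun h1 ↦ h1.2.1 (p136_mem_isogenyPrimes_of_reducible.irr_of_goodOrd_of_eleven_le hGr136 hgo h11 h13 h37)

/-- **No Eisenstein corner at a large multiplicative prime**: at a multiplicative `p ≥ 11` with
`p ∉ {13, 37}`, `E[p]` is irreducible, so `(E, p)` is not in X2. [folklore] -/
theorem not_classX2_of_mult_of_eleven_le_of_ne (hGr136 : p136_mem_isogenyPrimes_of_reducible)
    (hm : Mult W p) (h11 : 11 ≤ p) (h13 : p ≠ 13) (h37 : p ≠ 37) : ¬ ClassX2 W p :=
  fun h2 ↦ h2.2.1 (p136_mem_isogenyPrimes_of_reducible.irr_of_mult_of_eleven_le hGr136 hm h11 h13 h37)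

/-- **STRONG PARTIAL THEOREM, large good ORDINARY primes — NO CORNER.** Granted the fourteen named
published facts of the covered rows, BDMTV 2019 Thm 1.2 and Greenberg LNM 1716 p. 136: for EVERY
`E/ℚ` (globally minimal `W`, CM or not) of analytic rank `≤ 1` and EVERY good ordinary prime
`p ≥ 11` with `p ≠ 13`, `p ≠ 37`, Miller's `BSD(E,p)` holds. (PUB\* flag `BCS25-IMC-equiv@BSTW` on
the part that is neither (ram) ∧ `r = 0` nor semistable ∧ `r = 1`, travelling with `hBCS`.)
Proof: `E[p]` is irreducible by `hGr136`, then `Corners.bsdp_goodOrd_of_irr_of_eleven_le`.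
[folklore] -/
theorem bsdp_goodOrd_of_eleven_le_of_ne (hSk : Skinner2016.thmC_padicValRat_bsd_rank_zero)
    (hBCS : BurungaleCastellaSkinner2025.cor131_padicValRat_bsd_rank_le_one)
    (hJSW : JetchevSkinnerWan2017.thm121_padicValRat_bsd_rank_one)
    (hCGS : CastellaGrossiSkinner2025.thmD_padicValRat_bsd_rank_le_one)
    (hGV : GreenbergVatsal2000.thm13_charIdeal_eq_of_gvPar) (hGr : greenberg_charValue_rankZero)
    (hmod : hasEntireLFunction_rat) (hmodP : nonempty_modularParametrizationData)
    (hGZK : rank_eq_analyticRank_of_analyticRank_le_one)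
    (hCM : bsdTriple_of_hasCM_of_L_one_ne_zero) (hKob : Kobayashi2013.cor14_bsdp_of_cm_rank_one)
    (hYZ : YanZhu2026.thm415_padicValRat_bsd_rank_le_one)
    (hW20 : Wuthrich2014.lemma20_surjective_threeAdic_of_semistable)
    (hLLT : LiLiuTian2024.thm11_bsdp_of_cm_rank_one)
    (hBDMTV : BalakrishnanEtAl2019.thm12_not_le_normalizer_splitCartan)
    (hGr136 : p136_mem_isogenyPrimes_of_reducible)
    (hr : W.analyticRank ≤ 1) (hgo : GoodOrd W p) (h11 : 11 ≤ p) (h13 : p ≠ 13) (h37 : p ≠ 37) :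
    BSDp W p :=
  bsdp_goodOrd_of_irr_of_eleven_le hSk hBCS hJSW hCGS hGV hGr hmod hmodP hGZK hCM hKob hYZ hW20 hLLT
    hBDMTV hr hgo h11
    (p136_mem_isogenyPrimes_of_reducible.irr_of_goodOrd_of_eleven_le hGr136 hgo h11 h13 h37)

/-- **STRONG PARTIAL THEOREM, large MULTIPLICATIVE primes, rank `0` — the only corner is '(ram)
fails'.** Granted Skinner 2016 Thm C, modularity, GZK and Greenberg LNM 1716 p. 136: for every
`E/ℚ` of analytic rank `0` and every multiplicative prime `p ≥ 11` with `p ≠ 13`, `p ≠ 37`, `BSD(E,p)`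
holds unless `(E, p)` is in X11a (no multiplicative `q ≠ p` with `E[p]` ramified at `q`). The
Eisenstein corner X2 is excluded by `hGr136`. [folklore] -/
theorem bsdp_mult_rankZero_of_eleven_le_of_ne (hSk : Skinner2016.thmC_padicValRat_bsd_rank_zero)
    (hmod : hasEntireLFunction_rat) (hGZK : rank_eq_analyticRank_of_analyticRank_le_one)
    (hGr136 : p136_mem_isogenyPrimes_of_reducible)
    (hm : Mult W p) (hr0 : W.analyticRank = 0) (h11 : 11 ≤ p) (h13 : p ≠ 13) (h37 : p ≠ 37)
    (hX11a : ¬ ClassX11a W p) : BSDp W p :=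
  bsdp_mult_rankZero_of_not_corner hSk hmod hGZK (by omega) hm hr0 hX11a
    (not_classX2_of_mult_of_eleven_le_of_ne hGr136 hm h11 h13 h37)

/-- The same with the (ram) witness stated positively: at a multiplicative `p ≥ 11`,
`p ∉ {13, 37}`, in analytic rank `0`, a second multiplicative prime `q` with `p ∤ v_q(Δ_min)` gives
`BSD(E,p)` (Skinner 2016 Thm C; irreducibility automatic by `hGr136`). [folklore] -/
theorem bsdp_mult_rankZero_of_eleven_le_of_ram (hSk : Skinner2016.thmC_padicValRat_bsd_rank_zero)
    (hmod : hasEntireLFunction_rat) (hGZK : rank_eq_analyticRank_of_analyticRank_le_one)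
    (hGr136 : p136_mem_isogenyPrimes_of_reducible)
    (hm : Mult W p) (hr0 : W.analyticRank = 0) (h11 : 11 ≤ p) (h13 : p ≠ 13) (h37 : p ≠ 37)
    (hram : Ram W p) : BSDp W p :=
  bsdp_mult_rankZero_of_irr_of_ram hSk hmod hGZK (by omega) hm hr0
    (p136_mem_isogenyPrimes_of_reducible.irr_of_mult_of_eleven_le hGr136 hm h11 h13 h37) hram


/-! ### SHARP hypothesis lists at large primes (appended, rmap-1 gen 4, after referee-2 GEN 66's
informational nit `cornersAll-flagged-binders`: at a good ordinary `p ≥ 11` most of the fourteen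
binders of `Corners.lean` are idle — X9 is empty (BDMTV), the Eisenstein rows need `E[p]` reducible,
the supersingular / `p = 3` rows are off the axis). The theorems below name ONLY the facts used:
Burungale–Castella–Skinner 2025 Cor. 1.3.1 (`hBCS`, PUB\*: flag `BCS25-IMC-equiv@BSTW` travels, with
the informational `Wan15-Thm103-Fujiwara` and the pending (γ) provenance item of RESIDUAL-MAP §A),
GZK (`hGZK`), BDMTV 2019 Thm. 1.2 (`hBDMTV`), and — for CM curves / for dropping `Irr` — Rubin 1991 ∧
Burungale–Flach 2024 (`hCM`), Kobayashi 2013 Cor. 1.4 (`hKob`, PUB[sec] `KOB13-primary-unread`),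
modularity (`hmod`), Greenberg LNM 1716 p. 136 (`hGr136` = A163). No `hJSW`, `hYZ`, `hW20`, `hCGS`,
`hGV`, `hGr`, `hSk`, `hLLT`, `hmodP`: their flags do not ride along here. -/

/-- **Large-prime surjectivity from irreducibility (non-CM).** At a good ordinary `p ≥ 11`, a non-CM
`E/ℚ` with `E[p]` irreducible has `ρ̄_{E,p}` onto: otherwise Serre 1972 (§1.11 Prop. 11 + Props. 14,
17 — kernel theorems `exists_splitCartan_normalizer_of_goodOrd`) puts the image in the normaliser of
a split Cartan subgroup, contradicting Balakrishnan–Dogra–Müller–Tuitman–Vonk 2019 Thm. 1.2 (with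
Bilu–Parent–Rebolledo 2013; the named fact `hBDMTV`). This is the argument of
`ClassX9.eq_five_or_eq_seven` without the X9 rank clause. [folklore] -/
theorem surj_of_irr_of_eleven_le_of_not_hasCM
    (hBDMTV : BalakrishnanEtAl2019.thm12_not_le_normalizer_splitCartan)
    (hcm : ¬ W.HasCM) (hgo : GoodOrd W p) (h11 : 11 ≤ p) (hirr : Irr W p) : Surj W p := by
  by_contra hns
  obtain ⟨e, Φ, he, -⟩ := WeierstrassCurve.exists_frame_galoisRepTorsion_rat W p
  obtain ⟨P, -, hGN, -⟩ :=
    exists_splitCartan_normalizer_of_goodOrd W p Φ e he (by omega) hgo hirr hns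
  exact hBDMTV W p hcm (by omega) Φ e he P hGN

/-- **(im) at a large good ordinary prime (non-CM, irreducible)**: `ρ̄_{E,p}` onto (previous
theorem) and Serre's lifting lemma (`X9.bigIm_of_surj`, `p ≥ 5`) give BCS's big-image hypothesis
`BigIm W p`. [folklore] -/
theorem bigIm_of_irr_of_eleven_le_of_not_hasCM
    (hBDMTV : BalakrishnanEtAl2019.thm12_not_le_normalizer_splitCartan)
    (hcm : ¬ W.HasCM) (hgo : GoodOrd W p) (h11 : 11 ≤ p) (hirr : Irr W p) : BigIm W p :=
  X9.bigIm_of_surj W p (by omega) (surj_of_irr_of_eleven_le_of_not_hasCM hBDMTV hcm hgo h11 hirr)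

/-- **SHARP, non-CM, irreducible: THREE named facts.** For every non-CM `E/ℚ` of analytic rank
`≤ 1` and every good ordinary `p ≥ 11` with `E[p]` irreducible, `BSD(E,p)` follows from
Burungale–Castella–Skinner 2025 Cor. 1.3.1 (`hBCS`; PUB\*, flag `BCS25-IMC-equiv@BSTW` travels),
GZK (`hGZK`) and BDMTV 2019 Thm. 1.2 (`hBDMTV`): row C2 with (irr) given and (im) from the previous
theorem. [folklore] -/
theorem bsdp_goodOrd_of_irr_of_eleven_le_sharp
    (hBCS : BurungaleCastellaSkinner2025.cor131_padicValRat_bsd_rank_le_one)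
    (hGZK : rank_eq_analyticRank_of_analyticRank_le_one)
    (hBDMTV : BalakrishnanEtAl2019.thm12_not_le_normalizer_splitCartan)
    (hcm : ¬ W.HasCM) (hr : W.analyticRank ≤ 1) (hgo : GoodOrd W p) (h11 : 11 ≤ p)
    (hirr : Irr W p) : BSDp W p :=
  RowC2.bsdp hBCS hGZK hr
    ⟨hcm, by omega, hgo, hirr, bigIm_of_irr_of_eleven_le_of_not_hasCM hBDMTV hcm hgo h11 hirr⟩

/-- **SHARP, every curve, `p ∉ {13, 37}`: SEVEN named facts.** For EVERY `E/ℚ` (globally minimal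
`W`, CM or not) of analytic rank `≤ 1` and EVERY good ordinary prime `p ≥ 11` with `p ≠ 13`,
`p ≠ 37`, `BSD(E,p)` follows from: BCS 2025 Cor. 1.3.1 (`hBCS`, PUB\*), GZK (`hGZK`), BDMTV 2019
(`hBDMTV`), Greenberg LNM 1716 p. 136 (`hGr136` = A163: `E[p]` is irreducible here), and on the CM
branch Rubin 1991 ∧ Burungale–Flach 2024 (`hCM`, rank `0`), Kobayashi 2013 Cor. 1.4 (`hKob`, rank `1`,
PUB[sec]) with modularity (`hmod`, `r_an = 0 ↔ L(E,1) ≠ 0`). Same conclusion as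
`bsdp_goodOrd_of_eleven_le_of_ne`, with the nine idle binders dropped. [folklore] -/
theorem bsdp_goodOrd_of_eleven_le_of_ne_sharp
    (hBCS : BurungaleCastellaSkinner2025.cor131_padicValRat_bsd_rank_le_one)
    (hGZK : rank_eq_analyticRank_of_analyticRank_le_one)
    (hBDMTV : BalakrishnanEtAl2019.thm12_not_le_normalizer_splitCartan)
    (hCM : bsdTriple_of_hasCM_of_L_one_ne_zero) (hKob : Kobayashi2013.cor14_bsdp_of_cm_rank_one)
    (hmod : hasEntireLFunction_rat) (hGr136 : p136_mem_isogenyPrimes_of_reducible)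
    (hr : W.analyticRank ≤ 1) (hgo : GoodOrd W p) (h11 : 11 ≤ p) (h13 : p ≠ 13) (h37 : p ≠ 37) :
    BSDp W p := by
  by_cases hcm : W.HasCM
  · exact bsdp_cm_of_good_or_mult_rankZero hCM hKob hmod hr hcm (by omega) (Or.inl hgo.1)
  · exact bsdp_goodOrd_of_irr_of_eleven_le_sharp hBCS hGZK hBDMTV hcm hr hgo h11
      (p136_mem_isogenyPrimes_of_reducible.irr_of_goodOrd_of_eleven_le hGr136 hgo h11 h13 h37)

/-- **SHARP, every curve with `E[p]` irreducible, every good ordinary `p ≥ 11` (13 and 37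
included): SIX named facts** (`hBCS`, `hGZK`, `hBDMTV`, `hCM`, `hKob`, `hmod`). [folklore] -/
theorem bsdp_goodOrd_of_irr_of_eleven_le_allCurves_sharp
    (hBCS : BurungaleCastellaSkinner2025.cor131_padicValRat_bsd_rank_le_one)
    (hGZK : rank_eq_analyticRank_of_analyticRank_le_one)
    (hBDMTV : BalakrishnanEtAl2019.thm12_not_le_normalizer_splitCartan)
    (hCM : bsdTriple_of_hasCM_of_L_one_ne_zero) (hKob : Kobayashi2013.cor14_bsdp_of_cm_rank_one)
    (hmod : hasEntireLFunction_rat)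
    (hr : W.analyticRank ≤ 1) (hgo : GoodOrd W p) (h11 : 11 ≤ p) (hirr : Irr W p) : BSDp W p := by
  by_cases hcm : W.HasCM
  · exact bsdp_cm_of_good_or_mult_rankZero hCM hKob hmod hr hcm (by omega) (Or.inl hgo.1)
  · exact bsdp_goodOrd_of_irr_of_eleven_le_sharp hBCS hGZK hBDMTV hcm hr hgo h11 hirr

end Curve

end Summit.BirchSwinnertonDyer.Rank1Residual
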